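import Mathlib.Algebra.Lie.TraceForm
import Literature.MathematicalPhysics.QuantumLattice.RepLieAlgebra
import HarnessLib

/-!
# Route `BalabanLadder`, residual leg `UVOtherGroups` (stmt-QuantumFields-19356), non-`SU(N)` successor
# `UVNonSUNRec` (owner R85 batch item 2): the ONE route-posited group datum `LieRatio r λ`

D-0016 `<Route><Piece>Defs` file (objects the route's line posits, reviewed; nothing asserted).  The planner
line for the future residual `UVNonSUNRec` (cell ym-beyond, seat ym-novel-YangMills-othergroups; birth
skeleton `UVNonSUNRec-birth.lean` 420960d58324e780, shape-(K) variant 84e4709ec28db5ca) pins the two-loop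
asymptotic-scaling unit of an embedded compact simple group by ONE number: the Killing∕trace ratio `λ(G, r)`
of the concrete matrix Lie algebra `𝔨 = repLieSubalgebra r ⊂ 𝔲(r.N)` (tree `RepLieAlgebra.lean`).  This file
holds that definition VERBATIM (character-identical to the skeleton's local `LieRatio`, so the registered
stub `stub_lieRatio : … → ∃ lam, LieRatio r lam` is discharged by defeq from the companion proof file
`BalabanLadderUVNonSUNRecLieRatio.lean`, which proves `exists_lieRatio`).

`λ = C_A / T_r` (adjoint Casimir over the trace normalisation of `r`): `2N` for the fundamental of `SU(N)`,
`n − 2` for the vector representation of `SO(n)`, `1` for an adjoint representation.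

HONEST FRAMING: a definition and its uniqueness remark; classical Lie bookkeeping; nothing about the
Yang–Mills continuum limit, OS axioms or the mass gap is asserted here.  Authored with the planner seat
ym-novel-YangMills-othergroups g4 (candidate module 432c674c0de5048e), split per D-0016 by ym-osasm-p2 g5.

References: B. C. Hall, GTM 222 (2015), Prop. 7.4; M. Sepanski, *Compact Lie Groups* (2007), Thm. 5.18;
T. Bałaban, Commun. Math. Phys. 109 (1987) 249, p. 251 and p. 289 (the group enters the unit through `C_A/T_r`).
-/

set_option autoImplicit false

noncomputable section

open scoped Matrix
open Literature.MathematicalPhysics.QuantumFieldTheory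
open Literature.MathematicalPhysics.QuantumLattice

namespace Summit.QuantumFields.YangMills.Theorems.UVNonSUNRec

/-- **`LieRatio r λ` — the one group datum** of the non-`SU(N)` residual line: on the concrete matrix Lie
algebra `𝔨 = repLieSubalgebra r ⊂ 𝔲(r.N)` of the embedded compact group (`X ∈ 𝔨 ↔ ∀ t, exp(tX) ∈ r(G)`),
the Killing form is `λ` times the trace form `X ↦ Re tr X²`, with `λ > 0` and the trace form not
identically zero (so `λ` is unique, `LieRatio.unique`).  `λ = C_A/T_r`.  CHARACTER-IDENTICAL to the
definition in the planner's birth skeleton `UVNonSUNRec-birth.lean` (420960d58324e780). [problem-side definition] -/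
def LieRatio {G : Type} [Group G] [TopologicalSpace G] [CompactSpace G] (r : LatticeRep G) (lam : ℝ) : Prop :=
  0 < lam ∧ (∃ X : repLieSubalgebra r, ((X : Matrix (Fin r.N) (Fin r.N) ℂ) * X).trace.re ≠ 0) ∧
    ∀ X : repLieSubalgebra r,
      killingForm ℝ (repLieSubalgebra r) X X = lam * ((X : Matrix (Fin r.N) (Fin r.N) ℂ) * X).trace.re

/-- The ratio is unique (the trace form is not identically zero by the second conjunct). [folklore] -/
theorem LieRatio.unique {G : Type} [Group G] [TopologicalSpace G] [CompactSpace G] {r : LatticeRep G} {lam lam' : ℝ}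
    (h : LieRatio r lam) (h' : LieRatio r lam') : lam = lam' := by
  obtain ⟨X, hX⟩ := h.2.1
  exact mul_right_cancel₀ hX ((h.2.2 X).symm.trans (h'.2.2 X))

/-- The ratio is positive (first conjunct, for use by name). [folklore] -/
theorem LieRatio.pos {G : Type} [Group G] [TopologicalSpace G] [CompactSpace G] {r : LatticeRep G} {lam : ℝ}
    (h : LieRatio r lam) : 0 < lam :=
  h.1

end Summit.QuantumFields.YangMills.Theorems.UVNonSUNRec

end
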